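import Summits.FinalStateConjecture.FinalStateConjecture.Theorems.KerrnessPropagatesKillingSpinorEndgameLatenessIdle
import Summits.FinalStateConjecture.FinalStateConjecture.Theorems.KerrnessPropagatesKerrBasinCaptureStubLargeNearZones
import Literature.Geometry.Lorentzian.KerrScriLeafGap

/-!
# Recurrence slabs force growing near zones
# (crux stmt-FinalStateConjecture-17645 `KerrnessPropagates.KillingSpinorEndgame`; a statement-level
# consequence of clause (i), usable by every line through the crux or its restatements)

Clause (i) of `Theses.KerrnessPropagates.KillingSpinorEndgame` certifies, on ONE chart `Φ : U → M`, two
deviations of the SAME pulled-back metric `Φ^* g`: on the near disc of hole `i`,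
`{x⁰ = τ, ∀ j r₀ⱼ < rⱼ, rᵢ ≤ Rᵢ}`, it is `ε`-close in `Cᵏ` (sup) to the boosted Kerr–Schild form
`g_{Mᵢ,aᵢ} ∘ (Λᵢ, cᵢ)⁻¹`, and on the far zone `{x⁰ = τ, ∀ j r₀ⱼ < rⱼ, ∀ j Rⱼ − 1 ≤ rⱼ}` it is `ε`-close
to `η` (`SlabClauses`, the crux's block verbatim — `killingSpinorEndgame_iff` is `Iff.rfl`). Wherever
both hold the pulled-back metric cancels and the two BACKGROUNDS are `2ε`-close in operator norm
(`KerrBasinCapture.norm_sub_bilin_le`, landed with stub T2a of the sibling crux stmt-17646), while the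
Kerr–Schild ansatz `g_{M,a} = η + 2H ℓ ⊗ ℓ`, `ℓ(∂₀) = 1`, evaluated on the boosted time axis `Λ∂₀` has
the exact gap `2H`, `H = M r³/(r⁴ + a² z²) ≥ M r/(r² + a²)` (`Kerr.div_le_scalarH`; equality at the
poles). This file records the consequences for the ENDGAME's slab clauses, free of the margins /
recession hypotheses of T2a:

* `SlabClauses.mass_mul_radius_div_le` — at EVERY point of the slab lying in the near disc of hole `i`
  and in the far zone, `Mᵢ rᵢ(x)/(rᵢ(x)² + aᵢ²) ≤ ε ‖Λᵢ∂₀‖²` (any latitude);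
* `SlabClauses.mass_mul_div_le_or_nested` — for every hole `i` (any `N`), EITHER
  `Mᵢ Rᵢ/(Rᵢ² + aᵢ²) ≤ ε ‖Λᵢ∂₀‖²` OR the boosted polar point of hole `i` at rest-frame radius exactly
  `Rᵢ` (outer edge of its near zone) lies below the shell of another hole `j ≠ i`
  (`rⱼ ≤ r₀ⱼ` or `rⱼ < Rⱼ − 1`: nested / phantom configurations, the refuter's finding F3);
* `SlabClauses.mass_mul_div_le_one` — for ONE hole the second alternative is empty:
  `M R/(R² + a²) ≤ ε ‖Λ∂₀‖²` on EVERY `ε`-good one-hole slab, i.e. `R ≳ M/(ε‖Λ∂₀‖²)` as `ε → 0`.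

So a development recurring (clause (i)) to a configuration with `Mᵢ > 0` has certified near zones
that GROW without bound as `ε → 0` unless they nest: the quantitative form of "the near discs exhaust
the exterior" from which any dynamics stub (filed `Recurs`, or the restated `RecursLateFree` of
`Cruxes/KillingSpinorEndgame/Lines/registered_restated_c1.lean`, same slab block) starts, and the reason
`HasExhaustiveCharts`' demand `Rᵢ(τ) → ∞` costs a convergent global gauge nothing.

References: Kerr–Schild 1965 (ansatz and Lorentz covariance); Visser arXiv:0706.0622, (32)–(35); DHRT
arXiv:2104.08222, §1 (sup-norm deviations in one chart); Theses/KerrnessPropagates.lean (clause (i)).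
-/

open Literature.Geometry.Lorentzian
open scoped Manifold ContDiff Topology ENNReal
open Filter Set TopologicalSpace Function

-- `FinalStateConjecture.FinalStateConjecture` repeats summit = sub-problem (D-0017); deliberate.
set_option linter.dupNamespace false

noncomputable section

namespace Summit.FinalStateConjecture.FinalStateConjecture.Theorems.KerrnessPropagates

open Summit.FinalStateConjecture.FinalStateConjecture.Theses.KerrnessPropagates
open Summit.FinalStateConjecture.FinalStateConjecture.Theorems.KerrnessPropagates.KerrBasinCapture

/-! ### §1 The Kerr–Schild gap along the boosted time axis, at any latitude -/

/-- **Operator-norm lower bound for the Kerr–Schild gap at an arbitrary point**: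
`2 H(Λ⁻¹(x − c)) ≤ ‖g_{M,a}∘(Λ,c)⁻¹(x) − η‖ · ‖Λ∂₀‖²` — evaluate `g_{M,a} − η = 2H ℓ ⊗ ℓ` on
`(Λ∂₀, Λ∂₀)`, where `ℓ(∂₀) = 1` (the polar case, with `2H = 2Mr/(r² + a²)`, is
`KerrBasinCapture.two_mul_le_norm_boostedKerrBilin_sub`). Kerr–Schild 1965; Visser arXiv:0706.0622,
(32)–(34). [cite: KerrSchild1965] -/
theorem two_mul_scalarH_le_norm_boostedKerrBilin_sub (Λ : lorentzGroup) (c : E4) (M a : ℝ)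
    (x : E4) :
    2 * Kerr.scalarH M a (poincareInv Λ c x) ≤
      ‖boostedKerrBilin Λ c M a x - Minkowski.bilin‖ * ‖(Λ : E4 ≃L[ℝ] E4) (E4.basisVector 0)‖ ^ 2 := by
  set B := boostedKerrBilin Λ c M a x - Minkowski.bilin with hB
  set u := (Λ : E4 ≃L[ℝ] E4) (E4.basisVector 0) with hu
  have h1 : B u u = 2 * Kerr.scalarH M a (poincareInv Λ c x) := by
    rw [hB, hu, boostedKerrBilin_sub_minkowski_apply, ContinuousLinearEquiv.symm_apply_apply,
      sub_apply, sub_apply, Kerr.bilin_apply, Kerr.nullCovector_basisVector_zero]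
    ring
  calc 2 * Kerr.scalarH M a (poincareInv Λ c x) = B u u := h1.symm
    _ ≤ ‖B u u‖ := Real.le_norm_self _
    _ ≤ ‖B‖ * ‖u‖ * ‖u‖ := B.le_opNorm₂ u u
    _ = ‖B‖ * ‖u‖ ^ 2 := by ring

/-! ### §2 The slab clauses of the crux -/

section Slab

variable {X : Type} [TopologicalSpace X] [ChartedSpace E3 X] [IsManifold (𝓡 3) ∞ X]
  [ConnectedSpace X] {D : InitialDataSet (𝓡 3) X}

/-- **Radius forcing, pointwise** (clause (i) = `SlabClauses` verbatim): on an `ε`-good slab, at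
every point `x` of the punctured slab `{x⁰ = τ, ∀ j r₀ⱼ < rⱼ}` lying in the near disc of hole `i`
(`rᵢ(x) ≤ Rᵢ`) AND in the far zone (`∀ j, Rⱼ − 1 ≤ rⱼ(x)`),
`Mᵢ rᵢ(x) / (rᵢ(x)² + aᵢ²) ≤ ε ‖Λᵢ∂₀‖²` (`Mᵢ ≥ 0`, `r₀ᵢ ≥ 0`; `rᵢ = r(aᵢ, Λᵢ⁻¹(x − cᵢ))`): the two
certified deviations make `g_{Mᵢ,aᵢ}∘(Λᵢ,cᵢ)⁻¹(x)` and `η` `2ε`-close, against the gap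
`2H ≥ 2Mᵢrᵢ/(rᵢ² + aᵢ²)` on the boosted time axis. Kerr–Schild 1965; DHRT arXiv:2104.08222, §1.
[cite: KerrSchild1965] -/
theorem SlabClauses.mass_mul_radius_div_le {𝒟 : VacuumCauchyDevelopment D} {k N : ℕ}
    {M a r₀ : Fin N → ℝ} {mo : Fin N → ↥lorentzGroup × E4} {ε τ : ℝ} {R : Fin N → ℝ}
    {U : Opens E4} {Φ : U → 𝒟.carrier} (h : SlabClauses 𝒟 k N M a r₀ mo ε τ R U Φ)
    (hε : 0 ≤ ε) (i : Fin N) (hM : 0 ≤ M i) (hr₀ : 0 ≤ r₀ i) {x : E4} (hx0 : x 0 = τ)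
    (hpunct : ∀ j, r₀ j < Kerr.radius (a j) (poincareInv (mo j).1 (mo j).2 x))
    (hnear : Kerr.radius (a i) (poincareInv (mo i).1 (mo i).2 x) ≤ R i)
    (hfar : ∀ j, R j - 1 ≤ Kerr.radius (a j) (poincareInv (mo j).1 (mo j).2 x)) :
    M i * Kerr.radius (a i) (poincareInv (mo i).1 (mo i).2 x) /
        (Kerr.radius (a i) (poincareInv (mo i).1 (mo i).2 x) ^ 2 + a i ^ 2) ≤
      ε * ‖((mo i).1 : E4 ≃L[ℝ] E4) (E4.basisVector 0)‖ ^ 2 := by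
  obtain ⟨-, -, -, hsub, -, -, hnearC, hfarC, -⟩ := h
  have hxU : x ∈ (U : Set E4) := hsub ⟨hx0, hpunct⟩
  have hr : 0 < Kerr.radius (a i) (poincareInv (mo i).1 (mo i).2 x) := hr₀.trans_lt (hpunct i)
  have hdevK : ‖𝒟.toSpacetime.deviationExtend ⟨U, boostedKerrBilin (mo i).1 (mo i).2 (M i) (a i),
      fun y ↦ y 0, fun y ↦ Kerr.radius (a i) (poincareInv (mo i).1 (mo i).2 y)⟩ Φ x‖ ≤ ε :=
    norm_le_of_supCkENorm_le hε (hnearC i) ⟨hx0, hpunct, hnear⟩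
  have hdev0 : ‖𝒟.toSpacetime.deviationExtend (Minkowski.backgroundOn U) Φ x‖ ≤ ε :=
    norm_le_of_supCkENorm_le hε hfarC ⟨hx0, hpunct, hfar⟩
  have hclose : ‖boostedKerrBilin (mo i).1 (mo i).2 (M i) (a i) x - Minkowski.bilin‖ ≤ ε + ε :=
    norm_sub_bilin_le 𝒟.toSpacetime (Minkowski.backgroundOn U) _ _ _ Φ ⟨x, hxU⟩ hdev0 hdevK
  have hgap := two_mul_scalarH_le_norm_boostedKerrBilin_sub (mo i).1 (mo i).2 (M i) (a i) x
  have hH := Kerr.div_le_scalarH (a := a i) hM hr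
  have hv : 0 ≤ ‖((mo i).1 : E4 ≃L[ℝ] E4) (E4.basisVector 0)‖ ^ 2 := sq_nonneg _
  nlinarith [mul_le_mul_of_nonneg_right hclose hv]

/-- **Radius forcing at the outer edge, or nesting** (every `N`, every hole `i`, no recession or
margin hypotheses): on an `ε`-good slab with `Mᵢ ≥ 0`, `r₀ᵢ ≥ 0`, EITHER
`Mᵢ Rᵢ / (Rᵢ² + aᵢ²) ≤ ε ‖Λᵢ∂₀‖²` OR the boosted polar point `x` of hole `i` at rest-frame radius
exactly `Rᵢ` on the slab (`KerrBasinCapture.exists_polarPoint`) lies below the shell of some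
OTHER hole `j` (`rⱼ(x) ≤ r₀ⱼ` or `rⱼ(x) < Rⱼ − 1`: the outer edge of the near zone of hole `i` sits
in the excised ball or in the deep near zone of hole `j` — the nested / phantom configurations). Kerr–Schild 1965 (polar gap
`2MR/(R² + a²)`); DHRT arXiv:2104.08222, §1. [cite: KerrSchild1965] -/
theorem SlabClauses.mass_mul_div_le_or_nested {𝒟 : VacuumCauchyDevelopment D} {k N : ℕ}
    {M a r₀ : Fin N → ℝ} {mo : Fin N → ↥lorentzGroup × E4} {ε τ : ℝ} {R : Fin N → ℝ}
    {U : Opens E4} {Φ : U → 𝒟.carrier} (h : SlabClauses 𝒟 k N M a r₀ mo ε τ R U Φ)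
    (hε : 0 ≤ ε) (i : Fin N) (hM : 0 ≤ M i) (hr₀ : 0 ≤ r₀ i) :
    M i * R i / (R i ^ 2 + a i ^ 2) ≤ ε * ‖((mo i).1 : E4 ≃L[ℝ] E4) (E4.basisVector 0)‖ ^ 2 ∨
      ∃ x : E4, x 0 = τ ∧ Kerr.radius (a i) (poincareInv (mo i).1 (mo i).2 x) = R i ∧
        ∃ j, j ≠ i ∧ (Kerr.radius (a j) (poincareInv (mo j).1 (mo j).2 x) ≤ r₀ j ∨
          Kerr.radius (a j) (poincareInv (mo j).1 (mo j).2 x) < R j - 1) := by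
  obtain ⟨hR, -, -, hsub, -, -, hnearC, hfarC, -⟩ := h
  have hRpos : 0 < R i := by linarith [hR i]
  -- the boosted polar point of hole `i` at rest-frame radius `R i` on the slab `{x⁰ = τ}`
  obtain ⟨x, hx0, s, hxinv⟩ := exists_polarPoint (mo i).1 (mo i).2 τ (R i)
  have hri : Kerr.radius (a i) (poincareInv (mo i).1 (mo i).2 x) = R i := by
    rw [hxinv, Kerr.radius_add_time_smul_basisVector, KerrSchildChart.radius_polar _ hRpos.le]
  by_cases hA : ∀ j, r₀ j < Kerr.radius (a j) (poincareInv (mo j).1 (mo j).2 x) ∧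
      R j - 1 ≤ Kerr.radius (a j) (poincareInv (mo j).1 (mo j).2 x)
  · left
    have hpunct : ∀ j, r₀ j < Kerr.radius (a j) (poincareInv (mo j).1 (mo j).2 x) :=
      fun j ↦ (hA j).1
    have hfar : ∀ j, R j - 1 ≤ Kerr.radius (a j) (poincareInv (mo j).1 (mo j).2 x) :=
      fun j ↦ (hA j).2
    have hxU : x ∈ (U : Set E4) := hsub ⟨hx0, hpunct⟩
    have hdevK : ‖𝒟.toSpacetime.deviationExtend ⟨U, boostedKerrBilin (mo i).1 (mo i).2 (M i) (a i),
        fun y ↦ y 0, fun y ↦ Kerr.radius (a i) (poincareInv (mo i).1 (mo i).2 y)⟩ Φ x‖ ≤ ε :=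
      norm_le_of_supCkENorm_le hε (hnearC i) ⟨hx0, hpunct, hri.le⟩
    have hdev0 : ‖𝒟.toSpacetime.deviationExtend (Minkowski.backgroundOn U) Φ x‖ ≤ ε :=
      norm_le_of_supCkENorm_le hε hfarC ⟨hx0, hpunct, hfar⟩
    have hclose : ‖boostedKerrBilin (mo i).1 (mo i).2 (M i) (a i) x - Minkowski.bilin‖ ≤ ε + ε :=
      norm_sub_bilin_le 𝒟.toSpacetime (Minkowski.backgroundOn U) _ _ _ Φ ⟨x, hxU⟩ hdev0 hdevK
    have hgap := two_mul_le_norm_boostedKerrBilin_sub (mo i).1 (mo i).2 (M i) (a i) hRpos hxinv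
    have hv : 0 ≤ ‖((mo i).1 : E4 ≃L[ℝ] E4) (E4.basisVector 0)‖ ^ 2 := sq_nonneg _
    nlinarith [mul_le_mul_of_nonneg_right hclose hv]
  · right
    push Not at hA
    obtain ⟨j, hj⟩ := hA
    refine ⟨x, hx0, hri, j, ?_, ?_⟩
    · rintro rfl
      rw [hri] at hj
      linarith [hR j, hj (by linarith [hR j])]
    · by_cases hle : Kerr.radius (a j) (poincareInv (mo j).1 (mo j).2 x) ≤ r₀ j
      · exact Or.inl hle
      · exact Or.inr (hj (lt_of_not_ge hle))

/-- **One hole: every `ε`-good slab has a large near zone** — `M R / (R² + a²) ≤ ε ‖Λ∂₀‖²` for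
EVERY slab satisfying the clause-(i) block of `KillingSpinorEndgame` with `N = 1` (`M ≥ 0`,
`r₀ ≥ 0`; no lateness, recession or margin hypotheses). With `M > 0` this is `R ≳ M/(ε‖Λ∂₀‖²)`:
recurrence at every accuracy forces the certified near zones to exhaust the rest frame. The `N = 1`
sector is the support item `SingleKerrEndgame` (stmt-17647) and, by `recurrence_one_iff` (p152635),
exactly the sector on which clause (i) carries no lateness. Kerr–Schild 1965; DHRT
arXiv:2104.08222, §1. [cite: KerrSchild1965] -/
theorem SlabClauses.mass_mul_div_le_one {𝒟 : VacuumCauchyDevelopment D} {k : ℕ}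
    {M a r₀ : Fin 1 → ℝ} {mo : Fin 1 → ↥lorentzGroup × E4} {ε τ : ℝ} {R : Fin 1 → ℝ}
    {U : Opens E4} {Φ : U → 𝒟.carrier} (h : SlabClauses 𝒟 k 1 M a r₀ mo ε τ R U Φ)
    (hε : 0 ≤ ε) (hM : 0 ≤ M 0) (hr₀ : 0 ≤ r₀ 0) :
    M 0 * R 0 / (R 0 ^ 2 + a 0 ^ 2) ≤ ε * ‖((mo 0).1 : E4 ≃L[ℝ] E4) (E4.basisVector 0)‖ ^ 2 := by
  rcases h.mass_mul_div_le_or_nested hε 0 hM hr₀ with h1 | ⟨-, -, -, j, hj, -⟩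
  · exact h1
  · exact absurd (Subsingleton.elim j 0) hj

/-- **One hole, radius form**: `M R ≤ ε ‖Λ∂₀‖² (R² + a²)` on every `ε`-good one-hole slab; since
`R ≥ r₀ + 1 ≥ 1` and `a² < M²` for sub-extremal parameters this bounds `R` from BELOW by a quantity
`→ ∞` as `ε → 0` (for `ε ‖Λ∂₀‖² < M/(1 + M²)`, say, `R ≥ M/(2ε‖Λ∂₀‖²)` once `R ≥ |a|`).
Kerr–Schild 1965; DHRT arXiv:2104.08222, §1. [cite: KerrSchild1965] -/
theorem SlabClauses.mass_mul_le_one {𝒟 : VacuumCauchyDevelopment D} {k : ℕ}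
    {M a r₀ : Fin 1 → ℝ} {mo : Fin 1 → ↥lorentzGroup × E4} {ε τ : ℝ} {R : Fin 1 → ℝ}
    {U : Opens E4} {Φ : U → 𝒟.carrier} (h : SlabClauses 𝒟 k 1 M a r₀ mo ε τ R U Φ)
    (hε : 0 ≤ ε) (hM : 0 ≤ M 0) (hr₀ : 0 ≤ r₀ 0) :
    M 0 * R 0 ≤ ε * ‖((mo 0).1 : E4 ≃L[ℝ] E4) (E4.basisVector 0)‖ ^ 2 * (R 0 ^ 2 + a 0 ^ 2) := by
  have key := h.mass_mul_div_le_one hε hM hr₀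
  have hRpos : 0 < R 0 := by linarith [h.1 0]
  rwa [div_le_iff₀ (by positivity)] at key

/-- **One hole, in the crux's own hypotheses**: for a sub-extremal hole (`|a| < M`, so `M > 0` and
`r₋ ≥ 0`) with horizon-penetrating depth `r₀ ∈ (r₋, r₊)` — exactly the configuration hypothesis of
`KillingSpinorEndgame` / `KerrBasinCapture` / `SingleKerrEndgame` for `N = 1` — every `ε`-good slab
(`ε > 0`) has `M R ≤ ε ‖Λ∂₀‖² (R² + a²)`. Kerr–Schild 1965; DHRT arXiv:2104.08222, §1.
[cite: KerrSchild1965] -/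
theorem SlabClauses.mass_mul_le_one_of_isSubextremal {𝒟 : VacuumCauchyDevelopment D} {k : ℕ}
    {M a r₀ : Fin 1 → ℝ} {mo : Fin 1 → ↥lorentzGroup × E4} {ε τ : ℝ} {R : Fin 1 → ℝ}
    {U : Opens E4} {Φ : U → 𝒟.carrier} (h : SlabClauses 𝒟 k 1 M a r₀ mo ε τ R U Φ)
    (hε : 0 < ε) (hMa : Kerr.IsSubextremal (M 0) (a 0))
    (hr₀ : r₀ 0 ∈ Ioo (Kerr.rMinus (M 0) (a 0)) (Kerr.rPlus (M 0) (a 0))) :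
    M 0 * R 0 ≤ ε * ‖((mo 0).1 : E4 ≃L[ℝ] E4) (E4.basisVector 0)‖ ^ 2 * (R 0 ^ 2 + a 0 ^ 2) :=
  h.mass_mul_le_one hε.le hMa.pos.le (hMa.rMinus_nonneg.trans hr₀.1.le)

end Slab

/-- **Registered sub-goal `recurrence_forces_near_zone_radius` of crux stmt-FinalStateConjecture-17645**
(closed form of `SlabClauses.mass_mul_le_one_of_isSubextremal`): for every development, every ONE-hole
sub-extremal horizon-penetrating configuration and every `ε`-good slab of clause (i) of
`KillingSpinorEndgame`, `M R ≤ ε ‖Λ∂₀‖² (R² + a²)` — recurrence at every accuracy forces the certified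
near zones to grow without bound. Kerr–Schild 1965; DHRT arXiv:2104.08222, §1. [cite: KerrSchild1965] -/
theorem recurrence_forces_near_zone_radius : ∀ (X : Type) [TopologicalSpace X] [ChartedSpace E3 X] [IsManifold (𝓡 3) ∞ X] [ConnectedSpace X] (D : InitialDataSet (𝓡 3) X) (𝒟 : VacuumCauchyDevelopment D) (k : ℕ) (M a r₀ : Fin 1 → ℝ) (mo : Fin 1 → ↥lorentzGroup × E4) (ε τ : ℝ) (R : Fin 1 → ℝ) (U : Opens E4) (Φ : U → 𝒟.carrier), SlabClauses 𝒟 k 1 M a r₀ mo ε τ R U Φ → 0 < ε → Kerr.IsSubextremal (M 0) (a 0) → r₀ 0 ∈ Ioo (Kerr.rMinus (M 0) (a 0)) (Kerr.rPlus (M 0) (a 0)) → M 0 * R 0 ≤ ε * ‖((mo 0).1 : E4 ≃L[ℝ] E4) (E4.basisVector 0)‖ ^ 2 * (R 0 ^ 2 + a 0 ^ 2) :=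
  fun _ _ _ _ _ _ _ _ _ _ _ _ _ _ _ _ _ h hε hMa hr₀ ↦ h.mass_mul_le_one_of_isSubextremal hε hMa hr₀

end Summit.FinalStateConjecture.FinalStateConjecture.Theorems.KerrnessPropagates

end
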